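/-
Copyright: cell pub-balaban-gaps (YM BLITZ Y1, track G1), seat g1-p2 GEN 11 (unit `pub-balaban-gaps-g1-p2`).  Row (D4) NODE O, OBJECT ∕
MECHANISM level: the PER-CUBE COERCIVITY consumed by `D4WalkBlockLocalInverseGaugeEnd` supplied in FORM CURRENCY — the k-UNIFORM road for
covariant lattice operators located by g1-plan-1 GEN 38 ([G1-PLAN1-G38-PRECISION-136]∕[…-108] (σ)(σ′)(τ)(υ)): base conjugated coercivity `m`
of the flat operator `A₀` + GRADIENT DOMINATION `Σ_μ‖∇̃_μ z‖² ≤ γ·Re conjForm A₀ z + c_D‖z‖²` + the perturbation PRESENTED as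
`V = V₀ + Σ_μ B_μ·∇_μ` (zeroth order `V₀` with a Schur budget; MULTIPLIERS `B_μ` with conjugated row∕column letters `β_r(μ), β_c`) ⟹
conjugated coercivity of `A₀ + V`, margin `(1 − tβ_cγ∕2)m − α₀ − Σ_μβ_r(μ)∕(2t) − tβ_c c_D∕2`: the gradients (size `η⁻¹` on the fine lattice)
enter ONLY through the domination hypothesis — NO constant here depends on `‖∇_μ‖`.  GEN 10's one-entry Schur road (105
`gaugedCoercive_of_schur`, Schur sums of the WHOLE remainder) charges `‖∇_μ‖·β` and is k-DEPENDENT on the fine carrier ((σ′)); this is its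
k-free sibling at the cube level.  HONEST FRAMING: mechanism ([folklore]: Cauchy–Schwarz ∕ weighted Schur test with a parameter); base
coercivity, gradient domination, the presentation and its letters are hypothesis data; Bałaban's `Δ^{(k)}(𝐔)` NOT constructed; the GLOBAL
margin of the END (§5 = 104's `hq`, letters `C_K`, `c_s`) stays k-dependent on a fine carrier ((σ): the k-uniform consumer of the cube-level
coercivity is `D4WalkBlockDerivative.blockWalkExpansion_perturb_of_derivLetters`' pattern); (D4) instance 0∕1; NOT BetaPertH ∕ continuum ∕ Clay.
-/
import Summits.QuantumFields.BalabanUV.Gaps.D4WalkModelGaugedSchur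
import Summits.QuantumFields.BalabanUV.T4Continuum.Support.CTWeightedCoercivity
import Summits.QuantumFields.BalabanUV.Beta.UnitLatticeNearFar
import Literature.MathematicalPhysics.QuantumFieldTheory.Balaban1983to89.B4Ineq112ZeroNestNegFace

/-!
# `Gaps.D4WalkBlockFormCoercive` — conjugated coercivity of `A₀ + V₀ + Σ_μ B_μ∇_μ` from base coercivity, gradient domination and multiplier
# letters (FORM currency, gradient-free constants); compression to `□̃`; the per-cube gauged statement; Thm 3.10 at one scale from these
# (cell pub-balaban-gaps, seat g1-p2 gen 11)

HONEST DEPENDENCY (cell pub-balaban, verbatim): continuum YM on T⁴ ⇐ BetaPertH ∧ nine spine estimates (0/9 proved); BetaPertH ⇐ (D1) ∧ (D4) ∧ CAP+tail.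

[B9] (3.52)–(3.54), pp. 400–401: after the gauge fixing (3.35) on a cube the covariant operator is the flat one plus `V′`, whose terms are
`η⁻²(U − 1)`-multipliers next to ONE covariant difference, plus zeroth-order terms; p. 409: *"This theorem follows simply from Corollary 3.6
holding for all G′_□"*.  In quadratic-form currency the size-`η⁻¹` differences are absorbed by the flat form itself (`Re⟨z, Δ′(1)z⟩ ≥ Σ_μ‖∇_μ z‖²`),
so the perturbation costs only its MULTIPLIER letters — uniformly in the scale.  ABSTRACTLY ([folklore] throughout):
* §1 the weighted Schur test with a parameter `norm_form_le_schur_param` (`|u^*My| ≤ ½(R_r∕t·‖u‖² + tR_c·‖y‖²)`), its `ℓ²` case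
  `nsq_mulVec_le_schur`; `cRow ∕ cCol` as plain sums
  of the conjugated kernel `conjMat` (T4 substrate, BY NAME); the FIRST-ORDER budget `re_conjForm_mul_ge`:
  `Re conjForm (B·D) z ≥ −½(β_r∕t·‖z‖² + tβ_c·‖D̃z‖²)`, `D̃ = conjMat D`;
* §2 `conjForm_finset_sum`; **`conjCoercive_of_gradient`** — the abstract statement above;
* §3 compression to `S = □̃`: `conjMat_compress`, `compress_mulVec_apply`, `nsq_compress_mulVec_le`, **`gradDom_compress`** (domination passes
  to the compression: test at the zero-extension, drop the rows outside `S`), `compress_finset_sum`, `compress_presented` (the presentation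
  passes when the multipliers reduce `S`: 106's `compress_mul_of_reducing_left`);
* §4 **`gaugedCoercive_of_gradient`** — the per-cube statement in the hypothesis shape `hcoer` of 104's `blockWalkExpansion_gaugedAccretive`:
  the operator READ IN THE CUBE'S GAUGE presented as `A₀ + V₀(u) + Σ_μ B_μ(u)·D_μ`; base coercivity and gradient domination of `A₀` GLOBAL
  along every column weight; Schur budget of `compress V₀(u) □̃`; multipliers reducing `□̃` with letters ON `□̃`;
* §5 END **`blockWalkExpansion_gaugedGradient`** = 104's END with `hcoer` so discharged (sibling of 105's `blockWalkExpansion_gaugedSchur`).  WHAT IT IS NOT.  The instance for 59b–66's covariant operator on the fine torus (base coercivity = `B4Claim18ZeroTorusEta.form_lower18_unif` +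
a cosh budget; gradient domination of `ε⁻²Σ_μ(2 − S_μ − S_μ⁻¹)`; the presentation of `covOp(U^{u_□}) − covOp(1)` by the multipliers `ε⁻¹W^±_μ`,
`ε⁻²(W⁺_μ + W⁻_μ)`, `a_K(P_K(U) − P_K(1))` with their (3.37)-window letters) is NOT here; (D4) instance 0∕1; words of row (D4) UNCHANGED
(`ExistsUniformAcrossSmall 𝓣_Bałaban α Rσ₀ θ₀` + `TermDomination`, OBJECT level).

References (method only): T. Bałaban, Comm. Math. Phys. **99** (1985) 389–434 [B9], (3.35)–(3.37) p. 396, Thms 3.1–3.3 pp. 397–399, (3.52)–(3.54)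
pp. 400–401, Cor. 3.6 p. 408, p. 409, Thm 3.10 p. 416; Comm. Math. Phys. **116** (1988) [II], (1.11) p. 5, p. 15.
-/

noncomputable section

namespace Summit.QuantumFields.BalabanUV.Gaps.D4WalkBlockFormCoercive

open Metric Set Finset Complex Matrix
open scoped BigOperators Matrix ComplexConjugate
open Literature.MathematicalPhysics.QuantumFieldTheory.Balaban1983to89
open Literature.MathematicalPhysics.QuantumFieldTheory.Balaban1983to89.B9SectDWalk (DomBy)
open Literature.MathematicalPhysics.QuantumFieldTheory.Balaban1983to89.B9Thm34Ext (toB6)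
open Literature.MathematicalPhysics.QuantumFieldTheory.Balaban1983to89.B9Thm37GlueTorus (torusGeom tdist1)
open Literature.MathematicalPhysics.QuantumFieldTheory.Balaban1983to89.TreeLengthTorus (TPt)
open Literature.MathematicalPhysics.QuantumFieldTheory.Balaban1983to89.B5TorusCover (UT)
open Literature.MathematicalPhysics.QuantumFieldTheory.Balaban1983to89.B11SectG (RowSum)
open Literature.MathematicalPhysics.QuantumFieldTheory.Balaban1983to89.B5Prop11Lower (nsq nsq_nonneg star_dotProduct_self)
open Literature.MathematicalPhysics.QuantumFieldTheory.Balaban1983to89.B13DomainKernelWalks (DomainTerms)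
open Summit.QuantumFields.BalabanUV.Gaps.D4WalkBlock (blockNorm BlockWalkExpansion)
open Summit.QuantumFields.BalabanUV.T4Continuum.Spine.NE5.TwoRunPencilDomains (withOp)
open Summit.QuantumFields.BalabanUV.Beta.UnitLatticeWalkInversion (Hd)
open Summit.QuantumFields.BalabanUV.Beta.UnitLatticeLocalInverse (compress extend extendVec nsq_extendVec conjForm_compress
  conjCoercive_compress sum_eq_sum_subtype_of_support)
open Summit.QuantumFields.BalabanUV.Beta.AccretiveCombesThomas (conjForm conjForm_add)
open Summit.QuantumFields.BalabanUV.Beta.UnitLatticeNearFar (compress_add)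
open Literature.MathematicalPhysics.QuantumFieldTheory.Balaban1983to89.B4Ineq112ZeroNestNegFace (am_gm)
open Summit.QuantumFields.BalabanUV.T4Continuum.CTWeightedCoercivity (conjMat conjMat_apply conjMat_mul conjForm_eq)
open Summit.QuantumFields.BalabanUV.Gaps.D4WalkBlockShiftAlgebra (fibD)
open Summit.QuantumFields.BalabanUV.Gaps.D4WalkBlockLocalInverse (cRow cCol re_conjForm_ge_neg_schur)
open Summit.QuantumFields.BalabanUV.Gaps.D4WalkModelGaugedSchur (compress_mul_of_reducing_left)
open Summit.QuantumFields.BalabanUV.Gaps.D4WalkBlockLocalInverseGaugeEnd (blockWalkExpansion_gaugedAccretive)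

/-! ## §1. The weighted Schur test with a parameter; the first-order budget -/

section Schur

variable {ι : Type*} [Fintype ι]

/-- **the weighted Schur test with a parameter**: `|u^*My| ≤ ½(R_r∕t·‖u‖² + t·R_c·‖y‖²)` for row sums `≤ R_r`, column sums `≤ R_c`
of `M` and any `t > 0` (`u` pairs with the rows, `y` with the columns). [folklore] -/
theorem norm_form_le_schur_param (M : Matrix ι ι ℂ) {Rr Rc t : ℝ} (ht : 0 < t)
    (hr : ∀ e, ∑ e', ‖M e e'‖ ≤ Rr) (hc : ∀ e', ∑ e, ‖M e e'‖ ≤ Rc) (u y : ι → ℂ) :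
    ‖star u ⬝ᵥ (M *ᵥ y)‖ ≤ (Rr / t * nsq u + t * Rc * nsq y) / 2 := by
  have h1 : ‖star u ⬝ᵥ (M *ᵥ y)‖ ≤ ∑ e, ∑ e', ‖u e‖ * ‖M e e'‖ * ‖y e'‖ := by
    refine (norm_sum_le _ _).trans (Finset.sum_le_sum fun e _ => ?_)
    rw [Pi.star_apply, Matrix.mulVec, dotProduct, Finset.mul_sum]
    exact (norm_sum_le _ _).trans (Finset.sum_le_sum fun e' _ => by rw [norm_mul, norm_mul, norm_star, mul_assoc])
  have hpt : ∀ e e', ‖u e‖ * ‖M e e'‖ * ‖y e'‖ ≤ ‖u e‖ ^ 2 / (2 * t) * ‖M e e'‖ + t * ‖y e'‖ ^ 2 / 2 * ‖M e e'‖ := fun e e' =>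
    calc ‖u e‖ * ‖M e e'‖ * ‖y e'‖ = (‖u e‖ * ‖y e'‖) * ‖M e e'‖ := by ring
      _ ≤ (‖u e‖ ^ 2 / (2 * t) + t * ‖y e'‖ ^ 2 / 2) * ‖M e e'‖ := mul_le_mul_of_nonneg_right (am_gm ht) (norm_nonneg _)
      _ = _ := by ring
  have h2 : ∑ e, ∑ e', ‖u e‖ * ‖M e e'‖ * ‖y e'‖
      ≤ (∑ e, ‖u e‖ ^ 2 / (2 * t) * ∑ e', ‖M e e'‖) + ∑ e', t * ‖y e'‖ ^ 2 / 2 * ∑ e, ‖M e e'‖ := by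
    calc ∑ e, ∑ e', ‖u e‖ * ‖M e e'‖ * ‖y e'‖
        ≤ ∑ e, ∑ e', (‖u e‖ ^ 2 / (2 * t) * ‖M e e'‖ + t * ‖y e'‖ ^ 2 / 2 * ‖M e e'‖) :=
          Finset.sum_le_sum fun e _ => Finset.sum_le_sum fun e' _ => hpt e e'
      _ = (∑ e, ∑ e', ‖u e‖ ^ 2 / (2 * t) * ‖M e e'‖) + ∑ e, ∑ e', t * ‖y e'‖ ^ 2 / 2 * ‖M e e'‖ := by
          rw [← Finset.sum_add_distrib]; exact Finset.sum_congr rfl fun e _ => Finset.sum_add_distrib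
      _ = _ := by
          congr 1
          · exact Finset.sum_congr rfl fun e _ => by rw [Finset.mul_sum]
          · rw [Finset.sum_comm]; exact Finset.sum_congr rfl fun e' _ => by rw [Finset.mul_sum]
  have hrow : ∑ e, ‖u e‖ ^ 2 / (2 * t) * ∑ e', ‖M e e'‖ ≤ Rr / t * nsq u / 2 := by
    have hre : Rr / t * nsq u / 2 = ∑ e, ‖u e‖ ^ 2 / (2 * t) * Rr := by
      rw [nsq, Finset.mul_sum, Finset.sum_div]
      exact Finset.sum_congr rfl fun e _ => by have ht' : t ≠ 0 := ht.ne'; field_simp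
    rw [hre]
    exact Finset.sum_le_sum fun e _ => mul_le_mul_of_nonneg_left (hr e) (by positivity)
  have hcol : ∑ e', t * ‖y e'‖ ^ 2 / 2 * ∑ e, ‖M e e'‖ ≤ t * Rc * nsq y / 2 := by
    have hre : t * Rc * nsq y / 2 = ∑ e', t * ‖y e'‖ ^ 2 / 2 * Rc := by
      rw [nsq, Finset.mul_sum, Finset.sum_div]; exact Finset.sum_congr rfl fun e' _ => by ring
    rw [hre]
    exact Finset.sum_le_sum fun e' _ => mul_le_mul_of_nonneg_left (hc e') (by positivity)
  calc ‖star u ⬝ᵥ (M *ᵥ y)‖ ≤ _ := h1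
    _ ≤ _ := h2
    _ ≤ Rr / t * nsq u / 2 + t * Rc * nsq y / 2 := add_le_add hrow hcol
    _ = (Rr / t * nsq u + t * Rc * nsq y) / 2 := by ring

/-- **the Schur test in `ℓ²`**: `‖My‖² ≤ R_rR_c·‖y‖²` (the parameter test at `u = My`, `t = R_r`). [folklore] -/
theorem nsq_mulVec_le_schur (M : Matrix ι ι ℂ) {Rr Rc : ℝ} (hRr : 0 < Rr) (hr : ∀ e, ∑ e', ‖M e e'‖ ≤ Rr)
    (hc : ∀ e', ∑ e, ‖M e e'‖ ≤ Rc) (y : ι → ℂ) : nsq (M *ᵥ y) ≤ Rr * Rc * nsq y := by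
  have h := norm_form_le_schur_param M hRr hr hc (M *ᵥ y) y
  rw [star_dotProduct_self, Complex.norm_real, Real.norm_eq_abs, abs_of_nonneg (nsq_nonneg _), div_self hRr.ne'] at h
  linarith

omit [Fintype ι] in
/-- entries of the conjugated kernel in norm: `‖conjMat B (e,e′)‖ = ‖B(e,e′)‖·e^{κ(ρ_e − ρ_{e′})}`. [folklore] -/
theorem norm_conjMat_apply (κ : ℝ) (ρ : ι → ℝ) (B : Matrix ι ι ℂ) (e e' : ι) :
    ‖conjMat κ ρ ρ B e e'‖ = ‖B e e'‖ * Real.exp (κ * (ρ e - ρ e')) := by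
  rw [conjMat_apply, norm_mul, Complex.norm_real, Real.norm_eq_abs, abs_of_pos (Real.exp_pos _), mul_comm]

/-- the conjugated ROW sum `cRow` (GEN 5's currency) is the plain row sum of the conjugated kernel. [folklore] -/
theorem cRow_eq (B : Matrix ι ι ℂ) (κ : ℝ) (ρ : ι → ℝ) (e : ι) : cRow B κ ρ e = ∑ e', ‖conjMat κ ρ ρ B e e'‖ := by
  simp_rw [norm_conjMat_apply]; rfl

/-- the conjugated COLUMN sum `cCol` is the plain column sum of the conjugated kernel. [folklore] -/
theorem cCol_eq (B : Matrix ι ι ℂ) (κ : ℝ) (ρ : ι → ℝ) (e' : ι) : cCol B κ ρ e' = ∑ e, ‖conjMat κ ρ ρ B e e'‖ := by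
  simp_rw [norm_conjMat_apply]; rfl

/-- **THE FIRST-ORDER BUDGET**: for a product `B·D` (multiplier × gradient), `Re conjForm (B·D) z ≥ −½(β_r∕t·‖z‖² + t·β_c·‖D̃z‖²)`
with `D̃ = conjMat D` the conjugated gradient and `β_r ∕ β_c` the multiplier's conjugated row ∕ column sums: the gradient enters only
through `‖D̃z‖`. [folklore] -/
theorem re_conjForm_mul_ge (B D : Matrix ι ι ℂ) (κ : ℝ) (ρ : ι → ℝ) {βr βc t : ℝ} (ht : 0 < t)
    (hr : ∀ e, cRow B κ ρ e ≤ βr) (hc : ∀ e', cCol B κ ρ e' ≤ βc) (z : ι → ℂ) :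
    -((βr / t * nsq z + t * βc * nsq (conjMat κ ρ ρ D *ᵥ z)) / 2) ≤ (conjForm (B * D) κ ρ z).re := by
  have hform : conjForm (B * D) κ ρ z = star z ⬝ᵥ (conjMat κ ρ ρ B *ᵥ (conjMat κ ρ ρ D *ᵥ z)) := by
    rw [conjForm_eq, conjMat_mul κ ρ ρ ρ, ← Matrix.mulVec_mulVec]
  have hn := norm_form_le_schur_param (conjMat κ ρ ρ B) ht (fun e => by rw [← cRow_eq]; exact hr e)
    (fun e' => by rw [← cCol_eq]; exact hc e') z (conjMat κ ρ ρ D *ᵥ z)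
  rw [hform]
  have h' := Complex.abs_re_le_norm (star z ⬝ᵥ (conjMat κ ρ ρ B *ᵥ (conjMat κ ρ ρ D *ᵥ z)))
  linarith [neg_abs_le (star z ⬝ᵥ (conjMat κ ρ ρ B *ᵥ (conjMat κ ρ ρ D *ᵥ z))).re]

end Schur

/-! ## §2. Conjugated coercivity of `A₀ + V₀ + Σ_μ B_μ·D_μ` (the abstract statement) -/

section Abstract

variable {ι : Type*} [Fintype ι] {μs : Type*}

/-- finite additivity of the conjugated form in the kernel. [folklore] -/
theorem conjForm_finset_sum (s : Finset μs) (M : μs → Matrix ι ι ℂ) (κ : ℝ) (ρ : ι → ℝ) (z : ι → ℂ) :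
    conjForm (∑ μ ∈ s, M μ) κ ρ z = ∑ μ ∈ s, conjForm (M μ) κ ρ z := by
  induction s using Finset.cons_induction with
  | empty => simp [conjForm]
  | cons a s ha ih => rw [Finset.sum_cons, Finset.sum_cons, conjForm_add, ih]

variable [Fintype μs]

/-- **CONJUGATED COERCIVITY FROM BASE COERCIVITY, GRADIENT DOMINATION AND MULTIPLIER LETTERS.**  `A₀` conjugated-coercive `m`; the
conjugated gradients `D̃_μ = conjMat D_μ` dominated, `Σ_μ‖D̃_μ z‖² ≤ γ·Re conjForm A₀ z + c_D‖z‖²`; a zeroth-order part `V₀` costing `α₀`; multipliers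
`B_μ` with conjugated row sums `≤ β_r(μ)`, column sums `≤ β_c`; `0 < t`, `tβ_cγ ≤ 2` ⟹ `((1 − tβ_cγ∕2)m − α₀ − Σ_μβ_r(μ)∕(2t) − tβ_c c_D∕2)·‖z‖²
≤ Re conjForm (A₀ + V₀ + Σ_μ B_μD_μ) z` — no letter of the gradients themselves. [folklore] [cite: Balaban1985BackgroundPropagators, (3.52)–(3.54) pp.400–401, Cor. 3.6 p.408] -/
theorem conjCoercive_of_gradient (A₀ V₀ : Matrix ι ι ℂ) (B D : μs → Matrix ι ι ℂ) (κ : ℝ) (ρ : ι → ℝ)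
    {m γ cD α₀ βc t : ℝ} {βr : μs → ℝ}
    (hA : ∀ z, m * nsq z ≤ (conjForm A₀ κ ρ z).re)
    (hD : ∀ z, ∑ μ, nsq (conjMat κ ρ ρ (D μ) *ᵥ z) ≤ γ * (conjForm A₀ κ ρ z).re + cD * nsq z)
    (hV₀ : ∀ z, -(α₀ * nsq z) ≤ (conjForm V₀ κ ρ z).re)
    (hBr : ∀ μ e, cRow (B μ) κ ρ e ≤ βr μ) (hBc : ∀ μ e', cCol (B μ) κ ρ e' ≤ βc)
    (ht : 0 < t) (hβc : 0 ≤ βc) (htγ : t * βc * γ ≤ 2) (z : ι → ℂ) :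
    ((1 - t * βc * γ / 2) * m - α₀ - (∑ μ, βr μ) / (2 * t) - t * βc * cD / 2) * nsq z
      ≤ (conjForm (A₀ + V₀ + ∑ μ, B μ * D μ) κ ρ z).re := by
  set g : μs → ℝ := fun μ => nsq (conjMat κ ρ ρ (D μ) *ᵥ z) with hg
  have hfirst : ∀ μ, -(1 / (2 * t)) * nsq z * βr μ + -(t * βc / 2) * g μ ≤ (conjForm (B μ * D μ) κ ρ z).re := fun μ => by
    have he : -(1 / (2 * t)) * nsq z * βr μ + -(t * βc / 2) * g μ
        = -((βr μ / t * nsq z + t * βc * nsq (conjMat κ ρ ρ (D μ) *ᵥ z)) / 2) := by rw [hg]; ring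
    rw [he]; exact re_conjForm_mul_ge (B μ) (D μ) κ ρ ht (hBr μ) (hBc μ) z
  have hsum : -(1 / (2 * t)) * nsq z * (∑ μ, βr μ) + -(t * βc / 2) * ∑ μ, g μ
      ≤ (conjForm (∑ μ, B μ * D μ) κ ρ z).re := by
    rw [conjForm_finset_sum, Complex.re_sum, Finset.mul_sum, Finset.mul_sum, ← Finset.sum_add_distrib]
    exact Finset.sum_le_sum fun μ _ => hfirst μ
  have p1 : 0 ≤ (1 - t * βc * γ / 2) * ((conjForm A₀ κ ρ z).re - m * nsq z) := mul_nonneg (by linarith) (by linarith [hA z])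
  have p2 : 0 ≤ (t * βc / 2) * (γ * (conjForm A₀ κ ρ z).re + cD * nsq z - ∑ μ, g μ) := mul_nonneg (by positivity) (by linarith [hD z])
  rw [conjForm_add, conjForm_add, Complex.add_re, Complex.add_re]
  have h0 := hV₀ z; have ht' : t ≠ 0 := ht.ne'
  have key : ((1 - t * βc * γ / 2) * m - α₀ - (∑ μ, βr μ) / (2 * t) - t * βc * cD / 2) * nsq z
      = (conjForm A₀ κ ρ z).re + -(α₀ * nsq z)
        + (-(1 / (2 * t)) * nsq z * (∑ μ, βr μ) + -(t * βc / 2) * ∑ μ, g μ)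
        - (1 - t * βc * γ / 2) * ((conjForm A₀ κ ρ z).re - m * nsq z)
        - (t * βc / 2) * (γ * (conjForm A₀ κ ρ z).re + cD * nsq z - ∑ μ, g μ) := by field_simp; ring
  rw [key]
  linarith

end Abstract

/-! ## §3. Compression to `S = □̃` -/

section Compress

variable {Y : Type} [Fintype Y] [DecidableEq Y] {μs : Type*}

omit [Fintype Y] [DecidableEq Y] in
/-- compression commutes with conjugation (weights restricted to `S`). [folklore] -/
theorem conjMat_compress (κ : ℝ) (ρ : Y → ℝ) (M : Matrix Y Y ℂ) (S : Finset Y) :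
    conjMat κ (fun e : S => ρ e) (fun e : S => ρ e) (compress M S) = compress (conjMat κ ρ ρ M) S := by ext e e'; rfl

/-- the compressed kernel acts on `z` as the kernel acts on the zero-extension of `z`, read on `S`. [folklore] -/
theorem compress_mulVec_apply (N : Matrix Y Y ℂ) (S : Finset Y) (z : S → ℂ) (e : S) :
    (compress N S *ᵥ z) e = (N *ᵥ extendVec z) (e : Y) := by
  simp only [Matrix.mulVec, dotProduct]
  rw [sum_eq_sum_subtype_of_support S (fun k => N e k * extendVec z k) (fun k hk => by simp [extendVec, hk])]
  exact Finset.sum_congr rfl fun k _ => by simp [extendVec, k.2, compress]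

/-- `‖(compress N S)z‖² ≤ ‖N(extendVec z)‖²` (the rows outside `S` are dropped). [folklore] -/
theorem nsq_compress_mulVec_le (N : Matrix Y Y ℂ) (S : Finset Y) (z : S → ℂ) :
    nsq (compress N S *ᵥ z) ≤ nsq (N *ᵥ extendVec z) := by
  unfold nsq
  simp_rw [compress_mulVec_apply]
  rw [Finset.sum_coe_sort S (fun k : Y => ‖(N *ᵥ extendVec z) k‖ ^ 2)]
  exact Finset.sum_le_sum_of_subset_of_nonneg (Finset.subset_univ S) fun k _ _ => by positivity

/-- **gradient domination passes to the compression** (test the global inequality at the zero-extension; the compressed conjugated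
gradients lose only rows). [folklore] -/
theorem gradDom_compress [Fintype μs] (A : Matrix Y Y ℂ) (D : μs → Matrix Y Y ℂ) (S : Finset Y) (κ : ℝ) (ρ : Y → ℝ) {γ cD : ℝ}
    (hD : ∀ z : Y → ℂ, ∑ μ, nsq (conjMat κ ρ ρ (D μ) *ᵥ z) ≤ γ * (conjForm A κ ρ z).re + cD * nsq z) (z : S → ℂ) :
    ∑ μ, nsq (conjMat κ (fun e : S => ρ e) (fun e : S => ρ e) (compress (D μ) S) *ᵥ z)
      ≤ γ * (conjForm (compress A S) κ (fun e : S => ρ e) z).re + cD * nsq z := by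
  rw [conjForm_compress, ← nsq_extendVec z]
  exact le_trans (Finset.sum_le_sum fun μ _ => by rw [conjMat_compress]; exact nsq_compress_mulVec_le _ S z) (hD (extendVec z))

omit [Fintype Y] [DecidableEq Y] in
/-- compression of a finite sum. [folklore] -/
theorem compress_finset_sum (s : Finset μs) (M : μs → Matrix Y Y ℂ) (S : Finset Y) :
    compress (∑ μ ∈ s, M μ) S = ∑ μ ∈ s, compress (M μ) S := by
  induction s using Finset.cons_induction with
  | empty => rw [Finset.sum_empty, Finset.sum_empty]; rfl
  | cons a s ha ih => rw [Finset.sum_cons, Finset.sum_cons, compress_add, ih]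

omit [DecidableEq Y] in
/-- **the presentation passes to the compression** when every multiplier reduces `S` (`B_μ(i,j) ≠ 0 ⟹ (i ∈ S ↔ j ∈ S)`: a site
multiplier and a fibre-saturated `S`). [folklore] -/
theorem compress_presented [Fintype μs] (V₀ : Matrix Y Y ℂ) (B D : μs → Matrix Y Y ℂ) (S : Finset Y)
    (hB : ∀ μ i j, B μ i j ≠ 0 → (i ∈ S ↔ j ∈ S)) :
    compress (V₀ + ∑ μ, B μ * D μ) S = compress V₀ S + ∑ μ, compress (B μ) S * compress (D μ) S := by
  rw [compress_add, compress_finset_sum]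
  congr 1
  exact Finset.sum_congr rfl fun μ _ => compress_mul_of_reducing_left (hB μ) (D μ)

end Compress

/-! ## §4. The per-cube statement: gauged coercivity in form currency -/

section Gauged

variable {X : Type} {F : Type} [Fintype X] [Fintype F] [DecidableEq X] [DecidableEq F]
variable {E : Type*} {μs : Type*} [Fintype μs]

/-- **PER-CUBE GAUGED COERCIVITY IN FORM CURRENCY.**  For one cube: a site gauge with `fibD g·A(u)·fibD g⁻ = A₀ + V₀(u) + Σ_μ B_μ(u)·D_μ`
on the parameter set `B` (the operator read in the cube's gauge, PRESENTED: flat part + zeroth order + multipliers × gradients); along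
every column weight `d(·,j)`, `j ∈ S`: base conjugated coercivity `m` of `A₀` and gradient domination `(γ, c_D)` — both GLOBAL; conjugated
Schur sums `≤ a_r, a_c` of `compress V₀(u) S`; multipliers reducing `S` with conjugated row sums `≤ β_r(μ)` and column sums `≤ β_c` ON `S`;
`0 < t`, `tβ_cγ ≤ 2` ⟹ the gauged compression `compress (fibD g·A(u)·fibD g⁻) S` is conjugated-coercive
`(1 − tβ_cγ∕2)m − ½(a_r + a_c) − Σ_μβ_r(μ)∕(2t) − tβ_c c_D∕2` on `B`.  The gradients carry NO letter.
[cite: Balaban1985BackgroundPropagators, (3.35)–(3.37) p.396, (3.52)–(3.54) pp.400–401, Cor. 3.6 p.408] -/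
theorem gaugedCoercive_of_gradient {A : E → Matrix (X × F) (X × F) ℂ} {Bset : Set E} (A₀ : Matrix (X × F) (X × F) ℂ)
    (V₀ : E → Matrix (X × F) (X × F) ℂ) (Bm : μs → E → Matrix (X × F) (X × F) ℂ) (D : μs → Matrix (X × F) (X × F) ℂ)
    (S : Finset (X × F)) {g gi : X → Matrix F F ℂ}
    (hcov : ∀ u ∈ Bset, fibD X F g * A u * fibD X F gi = A₀ + V₀ u + ∑ μ, Bm μ u * D μ)
    (d : (X × F) → (X × F) → ℝ) {κ m γ cD ar ac βc t : ℝ} {βr : μs → ℝ}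
    (h0 : ∀ j : S, ∀ z : (X × F) → ℂ, m * nsq z ≤ (conjForm A₀ κ (fun e => d e j) z).re)
    (hD : ∀ j : S, ∀ z : (X × F) → ℂ,
      ∑ μ, nsq (conjMat κ (fun e => d e j) (fun e => d e j) (D μ) *ᵥ z) ≤ γ * (conjForm A₀ κ (fun e => d e j) z).re + cD * nsq z)
    (hVr : ∀ u ∈ Bset, ∀ (j : S) (e : S), cRow (compress (V₀ u) S) κ (fun e : S => d e j) e ≤ ar)
    (hVc : ∀ u ∈ Bset, ∀ (j : S) (e' : S), cCol (compress (V₀ u) S) κ (fun e : S => d e j) e' ≤ ac)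
    (hBS : ∀ μ u i j, Bm μ u i j ≠ 0 → (i ∈ S ↔ j ∈ S))
    (hBr : ∀ u ∈ Bset, ∀ μ (j : S) (e : S), cRow (compress (Bm μ u) S) κ (fun e : S => d e j) e ≤ βr μ)
    (hBc : ∀ u ∈ Bset, ∀ μ (j : S) (e' : S), cCol (compress (Bm μ u) S) κ (fun e : S => d e j) e' ≤ βc)
    (ht : 0 < t) (hβc : 0 ≤ βc) (htγ : t * βc * γ ≤ 2) :
    ∀ u ∈ Bset, ∀ j : S, ∀ z : S → ℂ,
      ((1 - t * βc * γ / 2) * m - (ar + ac) / 2 - (∑ μ, βr μ) / (2 * t) - t * βc * cD / 2) * nsq z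
        ≤ (conjForm (compress (fibD X F g * A u * fibD X F gi) S) κ (fun e : S => d e j) z).re := by
  intro u hu j z
  rw [hcov u hu, add_assoc, compress_add, compress_presented (V₀ u) (fun μ => Bm μ u) D S (fun μ => hBS μ u), ← add_assoc]
  exact conjCoercive_of_gradient (compress A₀ S) (compress (V₀ u) S) (fun μ => compress (Bm μ u) S)
    (fun μ => compress (D μ) S) κ (fun e : S => d e j)
    (conjCoercive_compress A₀ κ (fun e => d e j) (h0 j)) (gradDom_compress A₀ D S κ (fun e => d e j) (hD j))
    (re_conjForm_ge_neg_schur _ κ _ (hVr u hu j) (hVc u hu j)) (fun μ e => hBr u hu μ j e) (fun μ e' => hBc u hu μ j e')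
    ht hβc htγ z

end Gauged

/-! ## §5. END: Theorem 3.10 at one scale from per-cube base coercivity, gradient domination and multiplier letters -/

section End

variable {d N' : ℕ} {ν : ℕ} {K : Fin ν → ℕ} [∀ i, NeZero (K i)]
variable {X : Type} {F : Type} [Fintype X] [Fintype F] [DecidableEq X] [DecidableEq F]
variable {E : Type*} [NormedAddCommGroup E] [NormedSpace ℂ E] {μs : Type*} [Fintype μs]
variable {L₀ : DomainTerms d N' ν K (X × F) (X × F) E} {h : L₀.B → (X × F) → ℝ} {Es : L₀.B → Finset (X × F)}
variable {K' : E → Matrix (X × F) (X × F) ℂ} {A₀ : Matrix (X × F) (X × F) ℂ} {V₀ : L₀.B → E → Matrix (X × F) (X × F) ℂ}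
variable {Bm : L₀.B → μs → E → Matrix (X × F) (X × F) ℂ} {Dg : L₀.B → μs → Matrix (X × F) (X × F) ℂ}
variable {ds : (X × F) → (X × F) → ℝ}
variable {c : B13.Consts} {cub : X → UT K} {Xs : Finset (UT K)} {R CK M m m' γ cD ar ac βc t κc cs r₁ r rg rg' : ℝ} {βr : μs → ℝ}
variable {mJ nD nC : ℕ} {ρ₀ ε₀ κ₀ μ cμ : ℝ} {g gi : L₀.B → X → Matrix F F ℂ}

/-- **THEOREM 3.10 AT ONE SCALE FROM PER-CUBE BASE COERCIVITY, GRADIENT DOMINATION AND MULTIPLIER LETTERS.**  104's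
`blockWalkExpansion_gaugedAccretive` with its per-cube coercivity SUPPLIED by `gaugedCoercive_of_gradient`: per cube `□`, a gauge
`(g_□, g_□⁻)` in which `fibD g_□·(1 + K′(u))·fibD g_□⁻ = A₀ + V₀,□(u) + Σ_μ B_□,μ(u)·D_□,μ` on the ball (flat part + zeroth order +
multipliers × gradients), base coercivity `m` and gradient domination `(γ, c_D)` of `A₀` along every column weight, Schur sums `≤ a_r, a_c`
of `compress V₀,□(u) □̃`, multipliers reducing `□̃` with letters `β_r(μ), β_c` on `□̃`, and ANY `0 < m′ ≤` the form margin
`(1 − tβ_cγ∕2)m − ½(a_r + a_c) − Σ_μβ_r(μ)∕(2t) − tβ_c c_D∕2`; `C_L = r_gr_g′·c_s∕m′`.  The gradients `D_□,μ` (size `η⁻¹`) carry no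
letter; the GLOBAL margin `hq` (104's, with `C_K`, `c_s`) is untouched by this file.
[cite: Balaban1985BackgroundPropagators, (3.35) p.396, Thms 3.1–3.3 p.399, (3.52)–(3.54) pp.400–401, Cor. 3.6 p.408, Thm 3.7 p.409, Thm 3.10 p.416; Balaban1988RG2Cluster, (1.11) p.5, p.15] -/
theorem blockWalkExpansion_gaugedGradient
    (hanchor : ∀ b, L₀.anchor b ∈ L₀.dom b) (hdiam : ∀ b, ∀ z ∈ L₀.dom b, ∀ z' ∈ L₀.dom b, tdist1 K z z' ≤ r)
    (hJ : ∀ b, (L₀.J b).card ≤ mJ) (hX : ∀ b, (L₀.J b).Nonempty → (L₀.dom b ∩ Xs).Nonempty)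
    (hmult : ∀ z : UT K, (Finset.univ.filter fun b => L₀.anchor b = z).card ≤ nD)
    (hsupp : ∀ b y, y ∉ Es b → h b y = 0) (habs : ∀ b y, |h b y| ≤ 1)
    (hE : ∀ b y, y ∈ Es b → (fun p : X × F => cub p.1) y ∈ L₀.dom b)
    (hKan : ∀ i j, DifferentiableOn ℂ (fun u => K' u i j) (ball (0 : E) R))
    (hKbd : ∀ u ∈ ball (0 : E) R, ∀ y y', blockNorm (fun p : X × F => cub p.1) (fun p : X × F => cub p.1) (K' u) y y' ≤ CK)
    (hCK : 0 ≤ CK) (hM : 0 < M) (hr₁ : 0 ≤ r₁) (hsymm : ∀ i j, ds i j = ds j i) (hd0 : ∀ j, ds j j = 0)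
    (hLip : ∀ b i j, |h b i - h b j| ≤ ds i j / M) (hKrange : ∀ u i j, K' u i j ≠ 0 → ds i j ≤ r₁)
    (hdomE : ∀ b i, (∃ k ∈ Es b, ds i k ≤ r₁) → (fun p : X × F => cub p.1) i ∈ L₀.dom b)
    (hcard : ∀ b, (L₀.dom b).card ≤ nC) (hκc : 0 ≤ κc)
    (hEs : ∀ b, ∀ p ∈ Es b, ∀ a : F, (p.1, a) ∈ Es b)
    (hg : ∀ b x, g b x * gi b x = 1) (hgi : ∀ b x, gi b x * g b x = 1) (hrg0 : 0 ≤ rg) (hrg0' : 0 ≤ rg')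
    (hrg : ∀ b x a, ∑ b', ‖gi b x a b'‖ ≤ rg) (hrg' : ∀ b x a, ∑ b', ‖g b x a b'‖ ≤ rg')
    -- the operator in each cube's gauge PRESENTED; base coercivity; gradient domination; zeroth-order Schur; multiplier letters
    (hcov : ∀ b, ∀ u ∈ ball (0 : E) R, fibD X F (g b) * (1 + K' u) * fibD X F (gi b) = A₀ + V₀ b u + ∑ μ, Bm b μ u * Dg b μ)
    (h0 : ∀ b, ∀ j : Es b, ∀ z : (X × F) → ℂ, m * nsq z ≤ (conjForm A₀ κc (fun e => ds e j) z).re)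
    (hD : ∀ b, ∀ j : Es b, ∀ z : (X × F) → ℂ,
      ∑ μ, nsq (conjMat κc (fun e => ds e j) (fun e => ds e j) (Dg b μ) *ᵥ z) ≤ γ * (conjForm A₀ κc (fun e => ds e j) z).re + cD * nsq z)
    (hVr : ∀ b, ∀ u ∈ ball (0 : E) R, ∀ (j : Es b) (e : Es b), cRow (compress (V₀ b u) (Es b)) κc (fun e : Es b => ds e j) e ≤ ar)
    (hVc : ∀ b, ∀ u ∈ ball (0 : E) R, ∀ (j : Es b) (e' : Es b), cCol (compress (V₀ b u) (Es b)) κc (fun e : Es b => ds e j) e' ≤ ac)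
    (hBS : ∀ b μ u i j, Bm b μ u i j ≠ 0 → (i ∈ Es b ↔ j ∈ Es b))
    (hBr : ∀ b, ∀ u ∈ ball (0 : E) R, ∀ μ (j : Es b) (e : Es b), cRow (compress (Bm b μ u) (Es b)) κc (fun e : Es b => ds e j) e ≤ βr μ)
    (hBc : ∀ b, ∀ u ∈ ball (0 : E) R, ∀ μ (j : Es b) (e' : Es b), cCol (compress (Bm b μ u) (Es b)) κc (fun e : Es b => ds e j) e' ≤ βc)
    (ht : 0 < t) (hβc : 0 ≤ βc) (htγ : t * βc * γ ≤ 2) (hm' : 0 < m')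
    (hmargin : m' ≤ (1 - t * βc * γ / 2) * m - (ar + ac) / 2 - (∑ μ, βr μ) / (2 * t) - t * βc * cD / 2)
    (hcs : 0 ≤ cs) (hsite : ∀ i, ∑ j, Real.exp (-(κc * ds i j)) ≤ cs)
    (hκ₁ : 0 ≤ c.κ₁) (hμ : 0 ≤ μ) (hμε : 3 * μ ≤ ε₀) (hμκ : 2 * μ ≤ κ₀) (hwin : κ₀ + μ ≤ ρ₀ - ε₀) (hcμ : 0 ≤ cμ)
    (hrow : RowSum (toB6 (torusGeom K 0 0 0) 0 True) μ cμ)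
    (hq : cμ * (cμ * 1 *
      (1 * (((nC * (r₁ / M * CK) * (rg * rg' * (cs / m'))) * Real.exp (c.κ₁ * mJ) * Real.exp (2 * ρ₀ * r)) * Real.exp (μ * r) *
        (nD * cμ))) * cμ) * cμ < 1) :
    ∃ (W : Type) (T : W → (TPt d N' → ℂ) → E → Matrix (X × F) (X × F) ℂ) (SX : Set W) (A : W → ℝ) (D : W → UT K → UT K → ℝ)
      (ρ' : ℝ), BlockWalkExpansion c (fun p : X × F => cub p.1) (fun p : X × F => cub p.1)
        (fun σ₀ u =>
          (withOp L₀ fun b u => Hd h b * extend (compress (1 + K' u) (Es b))⁻¹ * Hd h b).kernel σ₀ u *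
          ((1 : Matrix (X × F) (X × F) ℂ) + (-1 : ℂ) •
            (withOp L₀ fun b u =>
              (Hd h b * K' u - K' u * Hd h b) * extend (compress (1 + K' u) (Es b))⁻¹ * Hd h b).kernel σ₀ u)⁻¹)
        Xs R (ε₀ - 3 * μ) (κ₀ - 2 * μ)
        (cμ * (((rg * rg' * (cs / m')) * Real.exp (c.κ₁ * mJ) * Real.exp (2 * ρ₀ * r)) * Real.exp (μ * r) * (nD * cμ)) *
          (1 * (1 - cμ * (cμ * 1 *
            (1 * (((nC * (r₁ / M * CK) * (rg * rg' * (cs / m'))) * Real.exp (c.κ₁ * mJ) * Real.exp (2 * ρ₀ * r)) *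
              Real.exp (μ * r) * (nD * cμ))) * cμ) * cμ)⁻¹) * cμ)
        T SX A D ρ' ∧
      ∀ ω, DomBy (toB6 (torusGeom K 0 0 0) 0 True) (D ω) := by
  have hS : ∀ b, ∀ u ∈ ball (0 : E) R, ∀ j : Es b, ∀ z : Es b → ℂ, m' * nsq z ≤
      (conjForm (compress (fibD X F (g b) * (1 + K' u) * fibD X F (gi b)) (Es b)) κc (fun e : Es b => ds e j) z).re := by
    intro b u hu j z
    have h := gaugedCoercive_of_gradient (A := fun u => 1 + K' u) (Bset := ball (0 : E) R) A₀ (V₀ b) (Bm b) (Dg b) (Es b)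
      (hcov b) ds (h0 b) (hD b) (hVr b) (hVc b) (hBS b) (hBr b) (hBc b) ht hβc htγ u hu j z
    exact le_trans (mul_le_mul_of_nonneg_right hmargin (nsq_nonneg z)) h
  exact blockWalkExpansion_gaugedAccretive hanchor hdiam hJ hX hmult hsupp habs hE hKan hKbd hCK hM hr₁ hsymm hd0 hLip hKrange hdomE
    hcard hm' hκc hEs hg hgi hrg0 hrg0' hrg hrg' hS hcs hsite hκ₁ hμ hμε hμκ hwin hcμ hrow hq

end End

end Summit.QuantumFields.BalabanUV.Gaps.D4WalkBlockFormCoercive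

end
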